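import Mathlib
import Summits.CriticalPhenomena.CardyFormulaZ2.Theorems.CardySelfRefinementRussoDriftModel
import Literature.Probability.Percolation.ProdBernoulliRusso
import HarnessLib

/-!
# The joint crossing probability `P` is a polynomial on the unit square

Support file for item `RussoDrift` (stmt-CriticalPhenomena-10271) of route `CardySelfRefinement`
(sub-problem `CriticalPhenomena/CardyFormulaZ2`); continuation of
`CardySelfRefinementRussoDriftModel`.  Adapted from `Cruxes/GradientComparability/Disproof.lean`
§5e (refuter-cdisprove gen 2), plus the `C¹` conclusion used by the forced-tangency argument.

* Coin-side pullback: the cylinder `Aloc` pulled back through `cfg k` is determined by the finite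
  coin window (`determinedBy_preimage_Aloc`; each fine edge reads at most three coins), so by the
  tree's multi-parameter cylinder formula `RussoPath.prodBernoulli_real_eq_sum_powerset`,
  `P` is a finite sum of products of coin biases `½`, `projIcc c`, `projIcc ρ` (`P_eq_sum_powerset`).
* `exists_contDiff_eq_P` — consequently, for `η ≠ 0` there is a `C¹` (indeed polynomial) function
  `Φ` on `ℝ²` agreeing with `(ρ, c) ↦ P k m F η ρ c` on `[0,1]²`.
-/

noncomputable section

namespace Summit.CriticalPhenomena.CardyFormulaZ2.Theorems.CardySelfRefinement

open scoped Topology BigOperators Classical ProbabilityTheory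
open Filter Set MeasureTheory Function TopologicalSpace
open Literature.Probability.LatticeModels Literature.Probability.Percolation
open Literature.Probability.Percolation.QuadCrossing
open Summit.CriticalPhenomena.CardyFormulaZ2.Theses.CardySelfRefinement

/-! ## Coin-side pullback: `P` is a polynomial in the coin biases -/

-- adapted from Cruxes/GradientComparability/Disproof.lean §5e
/-- `dirVec d d = 1`. -/
theorem dirVec_apply_self (d : Fin 2) : dirVec d d = 1 := by
  fin_cases d <;> simp [dirVec]

/-- `dirVec d i ≥ 0`. -/
theorem dirVec_apply_nonneg (d i : Fin 2) : 0 ≤ dirVec d i := by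
  fin_cases d <;> fin_cases i <;> simp [dirVec]

/-- Distinct representatives give distinct edges. -/
theorem edgeOf_injective : Function.Injective edgeOf := by
  rintro ⟨v, d⟩ ⟨v', d'⟩ h
  simp only [edgeOf] at h
  rw [Sym2.eq_iff] at h
  rcases h with ⟨h1, h2⟩ | ⟨h1, h2⟩
  · subst h1
    have hdd : dirVec d = dirVec d' := add_left_cancel h2
    have : d = d' := by
      have e := congrFun hdd d
      have e' := congrFun hdd d'
      fin_cases d <;> fin_cases d' <;> simp [dirVec] at e e' ⊢
    subst this
    rfl
  · exfalso
    have e1 := congrFun h1 d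
    have e2 := congrFun h2 d
    simp only [Pi.add_apply] at e1 e2
    have := dirVec_apply_self d
    have := dirVec_apply_nonneg d' d
    omega

/-- The coin window of a finite edge set is finite. -/
theorem coinWindow_finite (k : ℕ) {W : Set (Sym2 (Site 2))} (hW : W.Finite) :
    (coinWindow k W).Finite :=
  Set.Finite.biUnion (hW.preimage edgeOf_injective.injOn) fun _ _ =>
    ((Set.finite_singleton _).insert _).insert _

/-- The read-out of `vd` only depends on its three coins. -/
theorem opn_congr (k : ℕ) {S S' : Set (Site 2 × Fin 2 × Fin 3)} (vd : Site 2 × Fin 2)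
    (h : ∀ i ∈ coinsOf k vd, i ∈ S ↔ i ∈ S') : opn k S vd ↔ opn k S' vd := by
  obtain ⟨v, d⟩ := vd
  have h0 := h (v, d, 0) (by simp [coinsOf])
  have h1 := h (tb k (v, d), d, 1) (by simp [coinsOf])
  have h2 := h (tb k (v, d), d, 2) (by simp [coinsOf])
  simp only [opn]
  split_ifs
  · simp only [h0, h1, h2]
  · simp only [h0]

/-- Coin sets agreeing on `coinWindow k W` produce bond configurations agreeing on `W`. -/
theorem cfg_inter_eq_of_agree (k : ℕ) {W : Set (Sym2 (Site 2))} {S S' : Set (Site 2 × Fin 2 × Fin 3)}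
    (h : ∀ i ∈ coinWindow k W, (i ∈ S ↔ i ∈ S')) : cfg k S ∩ W = cfg k S' ∩ W := by
  have key : ∀ (v : Site 2) (d : Fin 2), s(v, v + dirVec d) ∈ W → (opn k S (v, d) ↔ opn k S' (v, d)) :=
    fun v d heW => opn_congr k (v, d) fun i hi => h i (Set.mem_biUnion (show (v, d) ∈ edgeOf ⁻¹' W from heW) hi)
  ext e
  simp only [Set.mem_inter_iff]
  constructor
  · rintro ⟨⟨v, d, rfl, hopn⟩, heW⟩
    exact ⟨⟨v, d, rfl, (key v d heW).1 hopn⟩, heW⟩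
  · rintro ⟨⟨v, d, rfl, hopn⟩, heW⟩
    exact ⟨⟨v, d, rfl, (key v d heW).2 hopn⟩, heW⟩

/-- **The pulled-back localised event is determined by the finite coin window.** -/
theorem determinedBy_preimage_Aloc (k m : ℕ) (F : Fin m → Quad (Set.univ : Set ℂ)) (η : ℝ) :
    DeterminedBy ((cfg k) ⁻¹' Aloc m F η) (coinWindow k (window m F η)) := by
  rw [determinedBy_iff]
  intro S S' hSS'
  have h : ∀ i ∈ coinWindow k (window m F η), (i ∈ S ↔ i ∈ S') := fun i hi =>
    ⟨fun hS => ((Set.ext_iff.1 hSS' i).1 ⟨hS, hi⟩).1, fun hS' => ((Set.ext_iff.1 hSS' i).2 ⟨hS', hi⟩).1⟩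
  simp only [Set.mem_preimage, Aloc, Set.mem_setOf_eq]
  rw [cfg_inter_eq_of_agree k h]

/-- **`P` as a finite sum of coin-cylinder weights** (multilinear polynomial in the biases). -/
theorem P_eq_sum_powerset (k m : ℕ) (F : Fin m → Quad (Set.univ : Set ℂ)) {η : ℝ} (hη : η ≠ 0)
    (ρ c : ℝ) (K : Finset (Site 2 × Fin 2 × Fin 3)) (hK : (↑K : Set _) = coinWindow k (window m F η)) :
    P k m F η ρ c = ∑ S ∈ K.powerset,
      if (↑S : Set (Site 2 × Fin 2 × Fin 3)) ∈ (cfg k) ⁻¹' Aloc m F η then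
        ∏ i ∈ K, (if i ∈ S then (prm k ρ c i : ℝ) else 1 - (prm k ρ c i : ℝ)) else 0 := by
  classical
  rw [P_eq_real_Aloc, Measure.real, Measure.map_apply (measurable_cfg k) (measurableSet_Aloc m F hη),
    ← Measure.real]
  have hdet : DeterminedBy ((cfg k) ⁻¹' Aloc m F η) (↑K : Set _) := hK ▸ determinedBy_preimage_Aloc k m F η
  rw [RussoPath.prodBernoulli_real_eq_sum_powerset hdet]

/-- Existence form: the window coin Finset exists for `η ≠ 0`. -/
theorem exists_coinFinset (k m : ℕ) (F : Fin m → Quad (Set.univ : Set ℂ)) {η : ℝ} (hη : η ≠ 0) :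
    ∃ K : Finset (Site 2 × Fin 2 × Fin 3), (↑K : Set _) = coinWindow k (window m F η) :=
  ⟨(coinWindow_finite k (window_finite m F hη)).toFinset, Set.Finite.coe_toFinset _⟩

/-! ## `P` is (the restriction of) a polynomial on the unit square -/

/-- On `[0,1]²` the clamped biases are the affine functions `½`, `c`, `ρ` of the parameters. -/
theorem coe_prm_eq (k : ℕ) {ρ c : ℝ} (hρ : ρ ∈ Set.Icc (0 : ℝ) 1) (hc : c ∈ Set.Icc (0 : ℝ) 1)
    (i : Site 2 × Fin 2 × Fin 3) :
    (prm k ρ c i : ℝ) = if i.2.2 = 0 then (if ax k (i.1, i.2.1) then 1 / 2 else c)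
      else if i.2.2 = 1 then 1 / 2 else ρ := by
  simp only [prm]
  split_ifs <;> simp [Set.projIcc_of_mem _ hρ, Set.projIcc_of_mem _ hc]

/-- **`P` is a polynomial on the square**: for `η ≠ 0` there is a `C¹` (indeed polynomial) function
`Φ` on `ℝ²` with `P k m F η ρ c = Φ (ρ, c)` for all `(ρ, c) ∈ [0,1]²`. -/
theorem exists_contDiff_eq_P (k m : ℕ) (F : Fin m → Quad (Set.univ : Set ℂ)) {η : ℝ} (hη : η ≠ 0) :
    ∃ Φ : ℝ × ℝ → ℝ, ContDiff ℝ 1 Φ ∧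
      ∀ ρ ∈ Set.Icc (0 : ℝ) 1, ∀ c ∈ Set.Icc (0 : ℝ) 1, P k m F η ρ c = Φ (ρ, c) := by
  classical
  obtain ⟨K, hK⟩ := exists_coinFinset k m F hη
  let b : (Site 2 × Fin 2 × Fin 3) → ℝ × ℝ → ℝ := fun i q =>
    if i.2.2 = 0 then (if ax k (i.1, i.2.1) then 1 / 2 else q.2) else if i.2.2 = 1 then 1 / 2 else q.1
  have hb : ∀ i, ContDiff ℝ 1 (b i) := by
    intro i
    simp only [b]
    split_ifs
    exacts [contDiff_const, contDiff_snd, contDiff_const, contDiff_fst]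
  refine ⟨fun q => ∑ S ∈ K.powerset,
      if (↑S : Set (Site 2 × Fin 2 × Fin 3)) ∈ (cfg k) ⁻¹' Aloc m F η then
        ∏ i ∈ K, (if i ∈ S then b i q else 1 - b i q) else 0, ?_, ?_⟩
  · refine ContDiff.sum fun S _ => ?_
    split_ifs
    · exact contDiff_prod fun i _ => by
        split_ifs
        exacts [hb i, contDiff_const.sub (hb i)]
    · exact contDiff_const
  · intro ρ hρ c hc
    rw [P_eq_sum_powerset k m F hη ρ c K hK]
    refine Finset.sum_congr rfl fun S _ => ?_
    split_ifs with hS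
    · refine Finset.prod_congr rfl fun i _ => ?_
      have hi : (prm k ρ c i : ℝ) = b i (ρ, c) := by
        rw [coe_prm_eq k hρ hc i]
      rw [hi]
    · rfl

end Summit.CriticalPhenomena.CardyFormulaZ2.Theorems.CardySelfRefinement

end
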